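import Summits.AtomisticToContinuum.Crystallization.Theorems.FrustratedLawDichotomyStrainedPatchHomHessPath
import Summits.AtomisticToContinuum.Crystallization.Theorems.FrustratedLawDichotomyStrainedPatchHomConvexCurvature
import Summits.AtomisticToContinuum.Crystallization.Theorems.FrustratedLawDichotomyStrainedPatchHomSplit

/-!
# First-order bookkeeping of the centred curvature leaf (real side): the linear term as an entrywise-bounded perturbation array

decomp-a2c hand-1 g27 (crux `AperiodicFrustratedLawGap`, stmt-AtomisticToContinuum-27623; `(H) HomFloor (1/625)`, hcp half; lever (C); hand-1 g27
FINDING «loss budget» (3a): label sums BEFORE absolute values).  `…HomHessPath.pathForm_secondOrder` leaves, per centred label, the linear term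
`DQ(p)[d] = α′(ρ₀)(⟪p,d⟫/ρ₀)⟪p,Δ⟫² + 2α(ρ₀)⟪p,Δ⟫⟪d,Δ⟫ + α(ρ₀)ρ₀(⟪p,d⟫/ρ₀)‖Δ‖²` (`β′ = αρ`).  This file rewrites it as the quadratic form of
`Σ_k d_k ∂_kh(p)`, `(∂_kh)_ij = (α′/ρ₀) p_k p_i p_j + α(δ_ik p_j + δ_jk p_i) + α p_k δ_ij` (§1), splits the displacement `d_b = (U − U_c)w_b + U(η − η_c)`
of the label point over the box (§2), collects the label sum into `P = Σ_kl (U − U_c)_kl G_kl + Σ_k (U(η − η_c))_k T_k` with `G_kl = Σ_b (w_b)_l ∂_kh_b`,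
`T_k = Σ_b ∂_kh_b` (§3), and bounds `P` ENTRYWISE from entrywise bounds of `G, T` (§4) — the `hP` input of `…HomHertzKit.quadForm_ge_of_hertzTest`.

NO definitions; 0 sorry; standard axioms; no instances / notation / `#eval`.  `--supports stmt-AtomisticToContinuum-27623`.
-/

noncomputable section

namespace Summit.AtomisticToContinuum.Crystallization.Theorems.FrustratedLawDichotomyStrainedPatchHomCurvCentre

open scoped BigOperators RealInnerProductSpace
open Summit.AtomisticToContinuum.Crystallization.Theorems.ChargedEnergyGapNegative (E3)
open Summit.AtomisticToContinuum.Crystallization.Theorems.FrustratedLawDichotomyStrainedPatchHomConvexCurvature (inner_eq_sum3 norm_sq_eq_sum)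
open Summit.AtomisticToContinuum.Crystallization.Theorems.FrustratedLawDichotomyStrainedPatchHomSplit (latPt)

/-! ## §1. The linear term as the quadratic form of `Σ_k d_k ∂_k h(p)` -/

/-- ★ **The first-order term is the form of `Σ_k d_k ∂_kh(p)`** with `(∂_kh)_ij = a₁ p_k p_i p_j + α(δ_ik p_j + δ_jk p_i) + α p_k δ_ij` (`a₁ = α′(ρ₀)/ρ₀`):
`Σ_ij (Σ_k d_k (∂_kh)_ij) Δ_iΔ_j = a₁⟪p,d⟫⟪p,Δ⟫² + 2α⟪p,Δ⟫⟪d,Δ⟫ + α⟪p,d⟫‖Δ‖²`. [arithmetic] -/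
theorem linForm_eq (p d Δ : E3) (a₁ α : ℝ) :
    ∑ i, ∑ j, (∑ k, d k * (a₁ * (p k * (p i * p j)) + (if i = k then α * p j else 0) + (if j = k then α * p i else 0) +
        (if i = j then α * p k else 0))) * (Δ i * Δ j) =
      a₁ * ⟪p, d⟫ * ⟪p, Δ⟫ ^ 2 + 2 * α * (⟪p, Δ⟫ * ⟪d, Δ⟫) + α * ⟪p, d⟫ * ‖Δ‖ ^ 2 := by
  simp only [inner_eq_sum3, norm_sq_eq_sum, Fin.sum_univ_three]
  simp only [Fin.isValue, ↓reduceIte, show ((0 : Fin 3) = 1) = False by decide, show ((0 : Fin 3) = 2) = False by decide,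
    show ((1 : Fin 3) = 0) = False by decide, show ((1 : Fin 3) = 2) = False by decide, show ((2 : Fin 3) = 0) = False by decide,
    show ((2 : Fin 3) = 1) = False by decide]
  ring

/-- The bracket of `…HomHessPath.pathForm_secondOrder` with `A₁(ρ₀) = α′`, `A(ρ₀) = α`, `B₁(ρ₀) = αρ₀` in the form of `linForm_eq` (`ρ₀ = ‖p‖ ≠ 0`,
`a₁ = α′/ρ₀`). [arithmetic] -/
theorem bracket_eq (p d Δ : E3) (α' α : ℝ) (hρ : ‖p‖ ≠ 0) :
    α' * (⟪p, d⟫ / ‖p‖) * ⟪p, Δ⟫ ^ 2 + 2 * α * (⟪p, Δ⟫ * ⟪d, Δ⟫) + α * ‖p‖ * (⟪p, d⟫ / ‖p‖) * ‖Δ‖ ^ 2 =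
      α' / ‖p‖ * ⟪p, d⟫ * ⟪p, Δ⟫ ^ 2 + 2 * α * (⟪p, Δ⟫ * ⟪d, Δ⟫) + α * ⟪p, d⟫ * ‖Δ‖ ^ 2 := by
  field_simp

/-! ## §2. The displacement of a label point over the box -/

/-- ★ **Displacement split**: `c_b(U, η) − c_b(U_c, η_c) = [latPt (U − U_c) f b + (U − U_c)(s + η_c)] + U(η − η_c)`. [arithmetic] -/
theorem labelPoint_sub_eq (U Uc : E3 →L[ℝ] E3) (f : Fin 3 → E3) (b : Fin 3 → ℤ) (s η ηc : E3) :
    (latPt U f b + U (s + η)) - (latPt Uc f b + Uc (s + ηc)) = (latPt (U - Uc) f b + (U - Uc) (s + ηc)) + U (η - ηc) := by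
  simp only [latPt, FunLike.coe_sub, Pi.sub_apply, map_add, map_sub]
  abel

/-- The components of a vector are bounded by bounds of an enclosure; `‖v‖² ≤ Σ_k D_k²` from `|v_k| ≤ D_k`. [folklore] -/
theorem norm_sq_le_of_abs_le (v : E3) (D : Fin 3 → ℝ) (h : ∀ k, |v k| ≤ D k) : ‖v‖ ^ 2 ≤ ∑ k, D k ^ 2 := by
  rw [norm_sq_eq_sum]
  exact Finset.sum_le_sum fun k _ => by
    have := h k
    rw [← sq_abs]
    exact pow_le_pow_left₀ (abs_nonneg _) this 2

/-- `‖v‖ ≤ √(Σ_k D_k²)`-type bound in squared form: `‖v‖ ≤ N` whenever `Σ_k D_k² ≤ N²`, `0 ≤ N`. [folklore] -/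
theorem norm_le_of_abs_le (v : E3) (D : Fin 3 → ℝ) (h : ∀ k, |v k| ≤ D k) {N : ℝ} (hN : 0 ≤ N) (hsq : ∑ k, D k ^ 2 ≤ N ^ 2) : ‖v‖ ≤ N := by
  have h2 : ‖v‖ ^ 2 ≤ N ^ 2 := (norm_sq_le_of_abs_le v D h).trans hsq
  have := abs_le_of_sq_le_sq h2 hN
  rwa [abs_of_nonneg (norm_nonneg v)] at this

/-! ## §3. Collecting the label sum: `P = Σ_kl ΔU_kl G_kl + Σ_k x_k T_k` -/

/-- ★ **Rearrangement of the first-order label sum** (one entry `ij` at a time): with `d_b,k = Σ_l ΔU_kl (w_b)_l + x_k`,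
`Σ_b Σ_k d_b,k D_b,k = Σ_k Σ_l ΔU_kl (Σ_b (w_b)_l D_b,k) + Σ_k x_k (Σ_b D_b,k)`. [arithmetic] -/
theorem pert_rearrange {ι : Type*} (B : Finset ι) (dU : Fin 3 → Fin 3 → ℝ) (x : Fin 3 → ℝ) (wv : ι → Fin 3 → ℝ) (D : ι → Fin 3 → ℝ) :
    ∑ b ∈ B, ∑ k, (∑ l, dU k l * wv b l + x k) * D b k =
      ∑ k, ∑ l, dU k l * (∑ b ∈ B, wv b l * D b k) + ∑ k, x k * ∑ b ∈ B, D b k := by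
  rw [Finset.sum_comm, ← Finset.sum_add_distrib]
  refine Finset.sum_congr rfl fun k _ => ?_
  calc ∑ b ∈ B, (∑ l, dU k l * wv b l + x k) * D b k
      = ∑ b ∈ B, ((∑ l, dU k l * (wv b l * D b k)) + x k * D b k) := by
        refine Finset.sum_congr rfl fun b _ => ?_
        rw [add_mul, Finset.sum_mul]
        congr 1
        exact Finset.sum_congr rfl fun l _ => by ring
    _ = (∑ b ∈ B, ∑ l, dU k l * (wv b l * D b k)) + ∑ b ∈ B, x k * D b k := Finset.sum_add_distrib
    _ = (∑ l, ∑ b ∈ B, dU k l * (wv b l * D b k)) + x k * ∑ b ∈ B, D b k := by rw [Finset.sum_comm, Finset.mul_sum]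
    _ = ∑ l, dU k l * (∑ b ∈ B, wv b l * D b k) + x k * ∑ b ∈ B, D b k := by
        congr 1
        exact Finset.sum_congr rfl fun l _ => by rw [Finset.mul_sum]

/-! ## §4. Entrywise bound of `P` -/

/-- ★ **Entrywise bound**: `|ΔU_kl| ≤ r_kl`, `|G_kl| ≤ g_kl`, `|x_k| ≤ ρ_k`, `|T_k| ≤ t_k` ⟹
`|Σ_kl ΔU_kl G_kl + Σ_k x_k T_k| ≤ Σ_kl r_kl g_kl + Σ_k ρ_k t_k`. [folklore] -/
theorem pert_abs_le (dU G r g : Fin 3 → Fin 3 → ℝ) (x T ρ t : Fin 3 → ℝ) (hdU : ∀ k l, |dU k l| ≤ r k l) (hG : ∀ k l, |G k l| ≤ g k l)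
    (hx : ∀ k, |x k| ≤ ρ k) (hT : ∀ k, |T k| ≤ t k) :
    |∑ k, ∑ l, dU k l * G k l + ∑ k, x k * T k| ≤ ∑ k, ∑ l, r k l * g k l + ∑ k, ρ k * t k := by
  have h1 : |∑ k, ∑ l, dU k l * G k l| ≤ ∑ k, ∑ l, r k l * g k l := by
    refine (Finset.abs_sum_le_sum_abs _ _).trans (Finset.sum_le_sum fun k _ => ?_)
    refine (Finset.abs_sum_le_sum_abs _ _).trans (Finset.sum_le_sum fun l _ => ?_)
    rw [abs_mul]
    exact mul_le_mul (hdU k l) (hG k l) (abs_nonneg _) ((abs_nonneg _).trans (hdU k l))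
  have h2 : |∑ k, x k * T k| ≤ ∑ k, ρ k * t k := by
    refine (Finset.abs_sum_le_sum_abs _ _).trans (Finset.sum_le_sum fun k _ => ?_)
    rw [abs_mul]
    exact mul_le_mul (hx k) (hT k) (abs_nonneg _) ((abs_nonneg _).trans (hx k))
  exact (abs_add_le _ _).trans (add_le_add h1 h2)

/-! ## §5. The centred label sum: matrix part + perturbation − remainder -/

/-- ★★ **Summing the per-label second-order floors.**  If for every label `b ∈ B`
`Q_b ≥ q_b + Σ_ij (Σ_k d_b,k D_b,k,ij) Δ_iΔ_j − R_b‖Δ‖²` (value at the centre + linear term − remainder), then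
`Σ_b Q_b ≥ Σ_b q_b + Σ_ij (Σ_b Σ_k d_b,k D_b,k,ij) Δ_iΔ_j − (Σ_b R_b)‖Δ‖²`. [arithmetic] -/
theorem sum_floor_collect {ι : Type*} (B : Finset ι) (Q q R : ι → ℝ) (d : ι → Fin 3 → ℝ) (D : ι → Fin 3 → Fin 3 → Fin 3 → ℝ) (Δ : E3)
    (h : ∀ b ∈ B, q b + ∑ i, ∑ j, (∑ k, d b k * D b k i j) * (Δ i * Δ j) - R b * ‖Δ‖ ^ 2 ≤ Q b) :
    (∑ b ∈ B, q b) + ∑ i, ∑ j, (∑ b ∈ B, ∑ k, d b k * D b k i j) * (Δ i * Δ j) - (∑ b ∈ B, R b) * ‖Δ‖ ^ 2 ≤ ∑ b ∈ B, Q b := by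
  have hlin : ∑ i, ∑ j, (∑ b ∈ B, ∑ k, d b k * D b k i j) * (Δ i * Δ j) = ∑ b ∈ B, ∑ i, ∑ j, (∑ k, d b k * D b k i j) * (Δ i * Δ j) := by
    calc ∑ i, ∑ j, (∑ b ∈ B, ∑ k, d b k * D b k i j) * (Δ i * Δ j)
        = ∑ i, ∑ j, ∑ b ∈ B, (∑ k, d b k * D b k i j) * (Δ i * Δ j) :=
          Finset.sum_congr rfl fun i _ => Finset.sum_congr rfl fun j _ => by rw [Finset.sum_mul]
      _ = ∑ i, ∑ b ∈ B, ∑ j, (∑ k, d b k * D b k i j) * (Δ i * Δ j) := Finset.sum_congr rfl fun i _ => Finset.sum_comm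
      _ = ∑ b ∈ B, ∑ i, ∑ j, (∑ k, d b k * D b k i j) * (Δ i * Δ j) := Finset.sum_comm
  rw [hlin, Finset.sum_mul B R (‖Δ‖ ^ 2), ← Finset.sum_add_distrib, ← Finset.sum_sub_distrib]
  exact Finset.sum_le_sum h

end Summit.AtomisticToContinuum.Crystallization.Theorems.FrustratedLawDichotomyStrainedPatchHomCurvCentre

end
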